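import Mathlib.Analysis.Complex.Basic
import Mathlib.Analysis.Convex.PathConnected
import Literature.Probability.RandomPlanarGeometry.ExteriorULC

/-!
# Stub `stub_greenKernelAsymptotics` of line `rainbow-monomials-in-excursion-kernels` — Part 2:
# a flat boundary point of a Jordan domain sees a half-disc
# (crux `BoundaryDefectGaussianR`, stmt-CriticalPhenomena-14132)

The stubs of the line quantify over boundary points `x` of a Jordan domain `D` that are FLAT:
every frontier point within distance `r` of `x` lies on the horizontal (or the vertical) line
through `x`. This file proves the plane-topology fact every use of that hypothesis starts from
(stub 5: "`V_n = {v : δ_n v ∈ D̄}` is a discrete half-plane near `x`, so a point with exactly one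
outside neighbour lies on the boundary row"; stub 6: "interior on the left"):

* `flat_halfDisc` — for a continuous real-linear functional `ℓ` and a Jordan domain whose frontier
  near `x` lies on the level line `{ℓ = ℓ x}`, the ball `B(x,r)` meets `closure D` exactly in one
  of the two closed half-discs `{ℓ ≥ ℓ x}` / `{ℓ ≤ ℓ x}` and meets `D` in the corresponding open
  half-disc;
* `flat_halfDisc_im`, `flat_halfDisc_re` — the horizontal / vertical instances in the exact
  phrasing of the registered stubs.

Proof: the two open half-discs are convex, hence connected, and miss `∂D`, so each lies in `D`
or in the exterior `(closure D)ᶜ` (Jordan curve theorem, tree file `ExteriorULC`); they cannot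
lie on the same side because `x` is a limit both of points of `D` and of exterior points and an
open set near a point of the level line can be pushed off the line to either side. [folklore]
-/

noncomputable section

namespace Summit.CriticalPhenomena.CardyFormulaZ2.Cruxes.BoundaryDefectGaussianR.RainbowMonomialsInExcursionKernels

open Set Metric Literature.Probability.RandomPlanarGeometry

/-- Pushing a point of an open set off a level line: if `W` is open, `p ∈ W ∩ B(x,r)`, then for
every direction `v` there is `t > 0` with `p + t v ∈ W ∩ B(x,r)`. [folklore] -/
theorem exists_add_smul_mem {W : Set ℂ} (hW : IsOpen W) {p x : ℂ} {r : ℝ} (hpW : p ∈ W)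
    (hp : dist p x < r) (v : ℂ) :
    ∃ t : ℝ, 0 < t ∧ p + (t : ℂ) * v ∈ W ∧ dist (p + (t : ℂ) * v) x < r := by
  have hO : IsOpen (W ∩ ball x r) := hW.inter isOpen_ball
  obtain ⟨ρ, hρ, hball⟩ := Metric.isOpen_iff.1 hO p ⟨hpW, mem_ball.2 hp⟩
  refine ⟨ρ / (2 * (‖v‖ + 1)), by positivity, ?_⟩
  have hmem : p + ((ρ / (2 * (‖v‖ + 1)) : ℝ) : ℂ) * v ∈ ball p ρ := by
    rw [mem_ball, dist_eq_norm, add_sub_cancel_left, norm_mul, Complex.norm_real,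
      Real.norm_eq_abs, abs_of_pos (by positivity)]
    have h1 : ρ / (2 * (‖v‖ + 1)) * ‖v‖ ≤ ρ / (2 * (‖v‖ + 1)) * (‖v‖ + 1) :=
      mul_le_mul_of_nonneg_left (by linarith) (by positivity)
    have h2 : ρ / (2 * (‖v‖ + 1)) * (‖v‖ + 1) = ρ / 2 := by
      field_simp
    linarith
  exact ⟨(hball hmem).1, mem_ball.1 (hball hmem).2⟩

/-- The core of the half-disc lemma: if the open half-disc `B(x,r) ∩ {ℓ > ℓ x}` lies in `D`, then
`B(x,r) ∩ closure D = B(x,r) ∩ {ℓ ≥ ℓ x}` and `B(x,r) ∩ D = B(x,r) ∩ {ℓ > ℓ x}`. [folklore] -/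
theorem flat_halfDisc_of_subset (D : JordanDomain) (ℓ : ℂ →L[ℝ] ℝ) (u : ℂ) (hu : 0 < ℓ u)
    {x : ℂ} (hx : x ∈ frontier D.carrier) {r : ℝ} (hr : 0 < r)
    (hflat : ∀ z ∈ frontier D.carrier, dist z x < r → ℓ z = ℓ x)
    (hUp : ball x r ∩ {z | ℓ x < ℓ z} ⊆ D.carrier) :
    (∀ z, dist z x < r → (z ∈ closure D.carrier ↔ ℓ x ≤ ℓ z)) ∧
      (∀ z, dist z x < r → (z ∈ D.carrier ↔ ℓ x < ℓ z)) := by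
  -- the lower open half-disc is connected and misses the frontier, hence lies in `D` or outside
  set Dn : Set ℂ := ball x r ∩ {z | ℓ z < ℓ x} with hDn
  have hDnconv : Convex ℝ Dn := by
    refine (convex_ball x r).inter ?_
    have := (convex_Iio (ℓ x)).linear_preimage (ℓ : ℂ →ₗ[ℝ] ℝ)
    simpa [Set.preimage] using this
  have hDnfr : Disjoint Dn (frontier D.carrier) := by
    refine Set.disjoint_left.2 fun z hz hzf => ?_
    have := hflat z hzf (mem_ball.1 hz.1)
    exact absurd this (ne_of_lt hz.2)
  have hDncover : Dn ⊆ D.carrier ∪ (closure D.carrier)ᶜ := fun z hz => by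
    by_cases hzD : z ∈ D.carrier
    · exact Or.inl hzD
    · exact Or.inr (D.mem_exterior_of_not_mem hzD fun h => Set.disjoint_left.1 hDnfr hz h)
  have hDnalt := hDnconv.isPreconnected.subset_or_subset D.isOpen D.isOpen_exterior
    D.disjoint_carrier_exterior hDncover
  -- `Dn ⊆ D` is impossible: an exterior point near `x` could be pushed into `Up ⊆ D`
  have hDnext : Dn ⊆ (closure D.carrier)ᶜ := by
    rcases hDnalt with h | h
    · exfalso
      obtain ⟨e, he, hxe⟩ := Metric.mem_closure_iff.1 (D.frontier_subset_closure_exterior' hx) r hr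
      have her : dist e x < r := by rwa [dist_comm] at hxe
      have heD : e ∉ D.carrier := fun h' => he (subset_closure h')
      have hℓe : ℓ e = ℓ x := by
        rcases lt_trichotomy (ℓ e) (ℓ x) with hlt | heq | hgt
        · exact absurd (h ⟨mem_ball.2 her, hlt⟩) heD
        · exact heq
        · exact absurd (hUp ⟨mem_ball.2 her, hgt⟩) heD
      obtain ⟨t, ht, hq, hqr⟩ := exists_add_smul_mem D.isOpen_exterior he her u
      have hℓq : ℓ x < ℓ (e + (t : ℂ) * u) := by
        rw [map_add, hℓe, show ((t : ℂ) * u) = (t : ℝ) • u by simp [Complex.real_smul],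
          ContinuousLinearMap.map_smul, smul_eq_mul]
        nlinarith
      exact hq (subset_closure (hUp ⟨mem_ball.2 hqr, hℓq⟩))
    · exact h
  refine ⟨fun z hz => ⟨fun hzc => ?_, fun hle => ?_⟩, fun z hz => ⟨fun hzD => ?_, fun hlt => ?_⟩⟩
  · -- `z ∈ closure D`: `ℓ z < ℓ x` would put `z` in `Dn ⊆ (closure D)ᶜ`
    by_contra hlt
    exact hDnext ⟨mem_ball.2 hz, lt_of_not_ge hlt⟩ hzc
  · rcases hle.lt_or_eq with hlt | heq
    · exact subset_closure (hUp ⟨mem_ball.2 hz, hlt⟩)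
    · -- on the level line: `z` is a limit of points of `Up ⊆ D`
      refine Metric.mem_closure_iff.2 fun ε hε => ?_
      obtain ⟨t, ht, hq, hqr⟩ := exists_add_smul_mem (isOpen_ball (x := z) (ε := ε))
        (mem_ball_self hε) hz u
      refine ⟨z + (t : ℂ) * u, hUp ⟨mem_ball.2 hqr, ?_⟩, mem_ball'.1 hq⟩
      show ℓ x < ℓ (z + (t : ℂ) * u)
      rw [map_add, ← heq, show ((t : ℂ) * u) = (t : ℝ) • u by simp [Complex.real_smul],
        ContinuousLinearMap.map_smul, smul_eq_mul]
      nlinarith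
  · -- `z ∈ D`: not in `Dn` (exterior), and not on the line (push down into `Dn` inside `D`)
    rcases lt_trichotomy (ℓ z) (ℓ x) with hlt | heq | hgt
    · exact absurd (subset_closure hzD) (hDnext ⟨mem_ball.2 hz, hlt⟩)
    · exfalso
      obtain ⟨t, ht, hq, hqr⟩ := exists_add_smul_mem D.isOpen hzD hz (-u)
      have hℓq : ℓ (z + (t : ℂ) * -u) < ℓ x := by
        rw [map_add, heq, show ((t : ℂ) * -u) = (t : ℝ) • (-u) by simp [Complex.real_smul],
          ContinuousLinearMap.map_smul, smul_eq_mul, map_neg]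
        nlinarith
      exact hDnext ⟨mem_ball.2 hqr, hℓq⟩ (subset_closure hq)
    · exact hgt
  · exact hUp ⟨mem_ball.2 hz, hlt⟩

/-- **A flat boundary point of a Jordan domain sees a half-disc.** Let `ℓ` be a continuous
real-linear functional on `ℂ` (not vanishing: `ℓ u > 0` for some `u`), `x ∈ ∂D`, and suppose every
frontier point of the Jordan domain `D` within distance `r` of `x` lies on the level line
`{ℓ = ℓ x}`. Then EITHER `B(x,r) ∩ D̄ = B(x,r) ∩ {ℓ ≥ ℓ x}` and `B(x,r) ∩ D = B(x,r) ∩ {ℓ > ℓ x}`,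
OR the same with the reversed inequalities. [folklore] -/
theorem flat_halfDisc (D : JordanDomain) (ℓ : ℂ →L[ℝ] ℝ) (u : ℂ) (hu : 0 < ℓ u) {x : ℂ}
    (hx : x ∈ frontier D.carrier) {r : ℝ} (hr : 0 < r)
    (hflat : ∀ z ∈ frontier D.carrier, dist z x < r → ℓ z = ℓ x) :
    ((∀ z, dist z x < r → (z ∈ closure D.carrier ↔ ℓ x ≤ ℓ z)) ∧
        (∀ z, dist z x < r → (z ∈ D.carrier ↔ ℓ x < ℓ z))) ∨
      ((∀ z, dist z x < r → (z ∈ closure D.carrier ↔ ℓ z ≤ ℓ x)) ∧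
        (∀ z, dist z x < r → (z ∈ D.carrier ↔ ℓ z < ℓ x))) := by
  set Up : Set ℂ := ball x r ∩ {z | ℓ x < ℓ z} with hUpdef
  set Dn : Set ℂ := ball x r ∩ {z | ℓ z < ℓ x} with hDndef
  -- both open half-discs are connected, miss `∂D`, hence lie in `D` or in the exterior
  have halt : ∀ S : Set ℂ, Convex ℝ S → Disjoint S (frontier D.carrier) →
      S ⊆ D.carrier ∨ S ⊆ (closure D.carrier)ᶜ := by
    intro S hS hSf
    have hcover : S ⊆ D.carrier ∪ (closure D.carrier)ᶜ := fun z hz => by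
      by_cases hzD : z ∈ D.carrier
      · exact Or.inl hzD
      · exact Or.inr (D.mem_exterior_of_not_mem hzD fun h => Set.disjoint_left.1 hSf hz h)
    exact hS.isPreconnected.subset_or_subset D.isOpen D.isOpen_exterior
      D.disjoint_carrier_exterior hcover
  have hUpconv : Convex ℝ Up := by
    refine (convex_ball x r).inter ?_
    have := (convex_Ioi (ℓ x)).linear_preimage (ℓ : ℂ →ₗ[ℝ] ℝ)
    simpa [Set.preimage] using this
  have hDnconv : Convex ℝ Dn := by
    refine (convex_ball x r).inter ?_
    have := (convex_Iio (ℓ x)).linear_preimage (ℓ : ℂ →ₗ[ℝ] ℝ)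
    simpa [Set.preimage] using this
  have hUpfr : Disjoint Up (frontier D.carrier) :=
    Set.disjoint_left.2 fun z hz hzf => absurd (hflat z hzf (mem_ball.1 hz.1)) (ne_of_gt hz.2)
  have hDnfr : Disjoint Dn (frontier D.carrier) :=
    Set.disjoint_left.2 fun z hz hzf => absurd (hflat z hzf (mem_ball.1 hz.1)) (ne_of_lt hz.2)
  rcases halt Up hUpconv hUpfr with hUpD | hUpE
  · exact Or.inl (flat_halfDisc_of_subset D ℓ u hu hx hr hflat hUpD)
  · rcases halt Dn hDnconv hDnfr with hDnD | hDnE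
    · -- apply the core lemma to `-ℓ`, whose upper half-disc is `Dn`
      right
      have hflat' : ∀ z ∈ frontier D.carrier, dist z x < r → (-ℓ) z = (-ℓ) x := fun z hz hzr => by
        simp only [neg_apply, hflat z hz hzr]
      have hUp' : ball x r ∩ {z | (-ℓ) x < (-ℓ) z} ⊆ D.carrier := by
        intro z hz
        refine hDnD ⟨hz.1, ?_⟩
        have h2 : (-ℓ) x < (-ℓ) z := hz.2
        simp only [neg_apply, neg_lt_neg_iff] at h2
        exact h2
      have hu' : 0 < (-ℓ) (-u) := by simp [hu]
      obtain ⟨h1, h2⟩ := flat_halfDisc_of_subset D (-ℓ) (-u) hu' hx hr hflat' hUp'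
      refine ⟨fun z hz => ?_, fun z hz => ?_⟩
      · rw [h1 z hz]; simp only [neg_apply, neg_le_neg_iff]
      · rw [h2 z hz]; simp only [neg_apply, neg_lt_neg_iff]
    · -- both half-discs exterior: a point of `D` near `x` could be pushed into `Up`
      exfalso
      obtain ⟨p, hp, hxp⟩ := Metric.mem_closure_iff.1 (frontier_subset_closure hx) r hr
      have hpr : dist p x < r := by rwa [dist_comm] at hxp
      have hpE : p ∉ (closure D.carrier)ᶜ := fun h => h (subset_closure hp)
      have hℓp : ℓ p = ℓ x := by
        rcases lt_trichotomy (ℓ p) (ℓ x) with hlt | heq | hgt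
        · exact absurd (hDnE ⟨mem_ball.2 hpr, hlt⟩) hpE
        · exact heq
        · exact absurd (hUpE ⟨mem_ball.2 hpr, hgt⟩) hpE
      obtain ⟨t, ht, hq, hqr⟩ := exists_add_smul_mem D.isOpen hp hpr u
      have hℓq : ℓ x < ℓ (p + (t : ℂ) * u) := by
        rw [map_add, hℓp, show ((t : ℂ) * u) = (t : ℝ) • u by simp [Complex.real_smul],
          ContinuousLinearMap.map_smul, smul_eq_mul]
        nlinarith
      exact hUpE ⟨mem_ball.2 hqr, hℓq⟩ (subset_closure hq)

/-- **Horizontal flat points** (the stubs' `(∀ z ∈ ∂D, dist z x < r → z.im = x.im)`): near `x`,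
`D̄` is the closed upper half-disc and `D` the open upper half-disc, or both are the lower ones.
[folklore] -/
theorem flat_halfDisc_im (D : JordanDomain) {x : ℂ} (hx : x ∈ frontier D.carrier) {r : ℝ}
    (hr : 0 < r) (hflat : ∀ z ∈ frontier D.carrier, dist z x < r → z.im = x.im) :
    ((∀ z, dist z x < r → (z ∈ closure D.carrier ↔ x.im ≤ z.im)) ∧
        (∀ z, dist z x < r → (z ∈ D.carrier ↔ x.im < z.im))) ∨
      ((∀ z, dist z x < r → (z ∈ closure D.carrier ↔ z.im ≤ x.im)) ∧
        (∀ z, dist z x < r → (z ∈ D.carrier ↔ z.im < x.im))) := by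
  have h := flat_halfDisc D Complex.imCLM Complex.I (by simp) hx hr
    (fun z hz hzr => by simpa using hflat z hz hzr)
  simpa using h

/-- **Vertical flat points** (the stubs' `(∀ z ∈ ∂D, dist z x < r → z.re = x.re)`): near `x`,
`D̄` is the closed right half-disc and `D` the open right half-disc, or both are the left ones.
[folklore] -/
theorem flat_halfDisc_re (D : JordanDomain) {x : ℂ} (hx : x ∈ frontier D.carrier) {r : ℝ}
    (hr : 0 < r) (hflat : ∀ z ∈ frontier D.carrier, dist z x < r → z.re = x.re) :
    ((∀ z, dist z x < r → (z ∈ closure D.carrier ↔ x.re ≤ z.re)) ∧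
        (∀ z, dist z x < r → (z ∈ D.carrier ↔ x.re < z.re))) ∨
      ((∀ z, dist z x < r → (z ∈ closure D.carrier ↔ z.re ≤ x.re)) ∧
        (∀ z, dist z x < r → (z ∈ D.carrier ↔ z.re < x.re))) := by
  have h := flat_halfDisc D Complex.reCLM 1 (by simp) hx hr
    (fun z hz hzr => by simpa using hflat z hz hzr)
  simpa using h

/-! ### Registered sub-goal of stub 5 carried by this file -/

/-- **Sub-goal `s5_flatHalfDisc` of stub 5** (registered on stmt-CriticalPhenomena-14132): at a
horizontally flat boundary point of a Jordan domain (the stubs' flatness hypothesis, verbatim),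
the closure of the domain is locally the closed upper half-disc and the domain the open upper
half-disc, or both are the lower ones (`flat_halfDisc_im`; the vertical case is
`flat_halfDisc_re`). This is the input "the lattice approximation `V_n = {v : δ_n v ∈ D̄}` is a
discrete half-plane near `x`" of stubs 5 and 6. [folklore] -/
theorem s5_flatHalfDisc : ∀ (D : Literature.Probability.RandomPlanarGeometry.JordanDomain) (x : ℂ), x ∈ frontier D.carrier → ∀ (r : ℝ), 0 < r → (∀ z ∈ frontier D.carrier, dist z x < r → z.im = x.im) → ((∀ z : ℂ, dist z x < r → (z ∈ closure D.carrier ↔ x.im ≤ z.im)) ∧ (∀ z : ℂ, dist z x < r → (z ∈ D.carrier ↔ x.im < z.im))) ∨ ((∀ z : ℂ, dist z x < r → (z ∈ closure D.carrier ↔ z.im ≤ x.im)) ∧ (∀ z : ℂ, dist z x < r → (z ∈ D.carrier ↔ z.im < x.im))) :=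
  fun D _ hx _ hr hflat => flat_halfDisc_im D hx hr hflat

end Summit.CriticalPhenomena.CardyFormulaZ2.Cruxes.BoundaryDefectGaussianR.RainbowMonomialsInExcursionKernels

end
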